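import Summits.HodgeConjecture.CorCM.GaloisOddPrimeShapesQuaternionBadB
import Summits.HodgeConjecture.CorCM.GaloisOddPrimeShapesHodge
import Summits.HodgeConjecture.CorCM.GaloisOddPrimeShapeCyclicModel
import Summits.HodgeConjecture.CorCM.GaloisOddSylowOrder
import Summits.HodgeConjecture.CorCM.GaloisTwoPowerStructure
import HarnessLib

/-!
# DEGREES `2ⁿ·p`, `p ∈ {3, 5, 7, 11, 13, 19, 37, 43}`, `n ≥ 5`: A GOOD GALOIS CM FIELD SATISFIES THE HODGE CONJECTURE FOR ALL POWERS OF ALL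
# ITS CM ABELIAN VARIETIES — the dichotomy «every CM abelian variety by `K` is stably nondegenerate, or `K` carries a simple
# degenerate one of dimension `[K:ℚ]/2` with an exceptional Hodge class»

COR-CM (cell `pub-hodgecm2`), binder seat b04 (gen 39), count-neutral own lane «Galois-CM-type classification».  KERNEL ONLY:
theorems; no definition, no named fact, no `sorry`.  `HC_CM` is neither used nor claimed (the results concern CM abelian varieties
whose CM field is a GOOD Galois CM field of the stated degrees).

By gen 39's classification `structure_of_forall_isNondegenerate_of_thirtytwo_dvd_of_prime_mem`
(`CorCM/GaloisOddPrimeShapesQuaternionBadB`; `p = 17` is excluded below only because its shape C(r) conditions depend on `n`): a GOOD Galois CM field `K` (all primitive CM types nondegenerate) of degree `2ⁿ·p`,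
`p ∈ {3,5,7,11,13,19,37,43}`, `n ≥ 5`, has `Gal(K/ℚ) = ⟨u⟩ ⋊ ⟨x⟩` (`x u x⁻¹ = uʳ`, shape C(r)) or `Gal(K/ℚ) = ⟨u⟩ ⋊ ⟨a, x⟩` of shape Dic.  For these
primes every shape C(r) satisfies gen 38's arithmetic conditions (`CorCM/GaloisOddPrimeShapeCyclicModel`,
`hodgeConjectureFor_pow_of_shape_C`: `r^{2^j} ≡ 1` with `j = 1` for `p = 3, 7, 11, 19, 43` and `j = 2` for `p = 5, 13, 37` — because `ord_p(r)` is a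
power of `2` dividing `gcd(2ⁿ, p − 1)` —, `2^{n−j+1} ∤ p − 1`, `2^{n−j} ∤ p + 1`), and shape Dic is GOOD for every `p`
(`hodgeConjectureFor_pow_of_shape_dic`).  Hence:

* §1 `pow_two_pow_mod_eq_one_of_conj` — `ord u = p`, `x^{2ⁿ} = 1`, `x u x⁻¹ = uʳ`, `2^{j+1} ∤ p − 1 ⟹ r^{2^j} ≡ 1 (mod p)`.
* §2 **`hodgeConjectureFor_pow_of_forall_isNondegenerate_of_prime_mem_eight`**: `K` GOOD of degree `2ⁿ·p` (`p ∈ {3,5,7,11,13,19,37,43}`,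
  `n ≥ 5`), `A` ANY abelian variety with CM by `K` (any CM type) ⟹ the Hodge conjecture holds for every power `A^N`;
  `isStablyNondegenerate_of_forall_isNondegenerate_of_prime_mem_eight`.
* §3 **`hodge_dichotomy_of_prime_mem_eight`**: for EVERY Galois CM field of such a degree, either every abelian variety with CM by
  `K` satisfies the Hodge conjecture together with all its powers, or `K` carries a simple DEGENERATE CM abelian variety of dimension
  `[K:ℚ]/2` with a rational `(p,p)` class outside the divisor ring on some power.
* §4 with gen 37's `2`-power case: **`hodgeConjectureFor_pow_of_forall_isNondegenerate_of_thirtytwo_dvd_of_mem`**,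
  **`hodge_dichotomy_of_thirtytwo_dvd_of_mem`** — `[K:ℚ] = 2ⁿ·M`, `n ≥ 5`, `M ∈ {1, 3, 5, 7, 11, 13, 19, 37, 43}`.
* §5 `hodgeConjectureFor_pow_of_forall_isNondegenerate_seventeen` — `p = 17` needs `n ≥ 8` (`ord r = 16` possible).

## References

* [Shimura1998] G. Shimura, *Abelian Varieties with Complex Multiplication and Modular Functions*, §6.2 Thm. 3, §8.2 Prop. 26, §32.10.
* [Gordon1999HodgeAVSurvey] B. B. Gordon, *A survey of the Hodge conjecture for abelian varieties*, Thm. 6.4, §9.3.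
* [Pohlmann1968] H. Pohlmann, *Algebraic cycles on abelian varieties of complex multiplication type*, Ann. of Math. 88 (1968), Thm. 1.
* [Dodson1984] B. Dodson, *The structure of Galois groups of CM-fields*, Trans. AMS 283 (1984), §3.1.1, §4.1, §5.
-/

noncomputable section

open CategoryTheory CategoryTheory.Limits NumberField
open scoped BigOperators

namespace Summit.HodgeConjecture.CorCM.GaloisModels

open Literature.NumberTheory.ComplexMultiplication Literature.AlgebraicGeometry.HodgeTheory
open Literature.AlgebraicGeometry.Motives (AbelianVariety CMType)
open Literature.AlgebraicGeometry.ComplexMultiplication (IsCMTypeRealisation)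
open Literature.AlgebraicGeometry.Pohlmann1968 Summit.HodgeConjecture.CorCM.GaloisRank
open Literature.Barriers.HodgeConjecture (divisorClassesSpan)

/-! ## §1 The order of the action is a power of two dividing `p − 1` -/

section GroupLemmas

variable {G : Type*} [Group G]

/-- `2^e ∣ 2^k` divides nothing that `2^e` does not divide. [folklore] -/
theorem not_two_pow_dvd_of_le {k m e : ℕ} (he : e ≤ k) (hm : ¬ 2 ^ e ∣ m) : ¬ 2 ^ k ∣ m :=
  fun h => hm (dvd_trans (pow_dvd_pow 2 he) h)

/-- **`ord u = p`, `x^{2ⁿ} = 1`, `x u x⁻¹ = uʳ`, `2^{j+1} ∤ p − 1 ⟹ r^{2^j} ≡ 1 (mod p)`**: the order of `r` in `(ℤ/p)ˣ` is a power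
of two dividing `gcd(2ⁿ, p − 1) ∣ 2^j`. [folklore] -/
theorem pow_two_pow_mod_eq_one_of_conj {u x : G} {p n r j : ℕ} [hp : Fact p.Prime] (hu : orderOf u = p)
    (hx : x ^ 2 ^ n = 1) (hxu : x * u * x⁻¹ = u ^ r) (hj : ¬ 2 ^ (j + 1) ∣ p - 1) : r ^ 2 ^ j % p = 1 := by
  -- `p ∤ r`
  have hr0 : (r : ZMod p) ≠ 0 := by
    intro h0
    rw [ZMod.natCast_eq_zero_iff] at h0
    have hur : u ^ r = 1 := orderOf_dvd_iff_pow_eq_one.mp (by rw [hu]; exact h0)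
    rw [hur, mul_inv_eq_one, mul_eq_left] at hxu
    have h1 : orderOf u = 1 := by rw [hxu, orderOf_one]
    rw [hu] at h1
    exact hp.out.one_lt.ne' h1
  -- `r^{2ⁿ} ≡ 1`
  have h1 : (r : ZMod p) ^ 2 ^ n = 1 := by
    have h := pow_conj_eq_pow_pow hxu (2 ^ n)
    rw [hx, one_mul, inv_one, mul_one] at h
    have hmod : r ^ 2 ^ n ≡ 1 [MOD p] := by
      rw [← hu, Nat.ModEq.comm]
      have : u ^ (r ^ 2 ^ n) = u ^ 1 := by rw [pow_one]; exact h.symm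
      exact (pow_eq_pow_iff_modEq.mp this).symm
    have := (ZMod.natCast_eq_natCast_iff _ _ _).mpr hmod
    rwa [Nat.cast_pow, Nat.cast_one] at this
  -- `r^{p−1} ≡ 1`
  have h2 : (r : ZMod p) ^ (p - 1) = 1 := ZMod.pow_card_sub_one_eq_one hr0
  have h3 : (r : ZMod p) ^ Nat.gcd (2 ^ n) (p - 1) = 1 := pow_gcd_eq_one.mpr ⟨h1, h2⟩
  -- `gcd(2ⁿ, p−1) ∣ 2^j`
  have hgcd : Nat.gcd (2 ^ n) (p - 1) ∣ 2 ^ j := by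
    obtain ⟨i, hi, heq⟩ := (Nat.dvd_prime_pow Nat.prime_two).mp (Nat.gcd_dvd_left (2 ^ n) (p - 1))
    rw [heq]
    refine pow_dvd_pow 2 ?_
    by_contra hij
    exact hj (dvd_trans (pow_dvd_pow 2 (by omega)) (heq ▸ Nat.gcd_dvd_right (2 ^ n) (p - 1)))
  have h4 : (r : ZMod p) ^ 2 ^ j = 1 := by
    obtain ⟨k, hk⟩ := hgcd
    rw [hk, pow_mul, h3, one_pow]
  have h5 := (ZMod.natCast_eq_natCast_iff' (r ^ 2 ^ j) 1 p).mp (by rw [Nat.cast_pow, Nat.cast_one]; exact h4)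
  rwa [Nat.mod_eq_of_lt hp.out.one_lt] at h5

end GroupLemmas

variable {K : Type} [Field K] [NumberField K] [IsCMField K] [IsGalois ℚ K]
variable {Φ : CMType K} {A : AbelianVariety ℂ} {ι : 𝓞 K →+* End A} {θ : K →+* Module.End ℂ (complexBetti A.X 1)}

/-! ## §2 GOOD ⟹ the Hodge conjecture for all powers of all CM abelian varieties by `K` -/

/-- **GOOD GALOIS CM FIELDS OF DEGREE `2ⁿ·p`, `p ∈ {3,5,7,11,13,19,37,43}`, `n ≥ 5`: THE HODGE CONJECTURE FOR ALL POWERS OF EVERY ABELIAN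
VARIETY WITH CM BY `K`** (any CM type, simple or not).  GOOD ⟹ shape C(r) or Dic (gen 39); C(r): `ord_p(r) ∣ gcd(2ⁿ, p−1) ∈ {2, 4}`,
so gen 38's `hodgeConjectureFor_pow_of_shape_C` applies with `j = 1` (`p = 3, 7, 11, 19, 43`) or `j = 2` (`p = 5, 13, 37`) — its residue
conditions `2^{n−j+1} ∤ p−1`, `2^{n−j} ∤ p+1` hold for `n ≥ 5`; Dic: `hodgeConjectureFor_pow_of_shape_dic`.
[cite: Pohlmann1968, Thm. 1] [cite: Shimura1998, §8.2 Prop. 26 and §32.10] [cite: Gordon1999HodgeAVSurvey, Thm. 6.4 and §9.3] -/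
theorem hodgeConjectureFor_pow_of_forall_isNondegenerate_of_prime_mem_eight {n p : ℕ}
    (hp : p = 3 ∨ p = 5 ∨ p = 7 ∨ p = 11 ∨ p = 13 ∨ p = 19 ∨ p = 37 ∨ p = 43) (hdeg : Module.finrank ℚ K = 2 ^ n * p) (hn : 5 ≤ n)
    (hgood : ∀ (Ψ : CMType K) (φ : K →+* ℂ), IsPrimitive (ℂ ≃+* ℂ) Ψ.1 φ → IsNondegenerate Ψ)
    (hA : IsCMTypeRealisation Φ A ι θ) (N : ℕ) :
    HodgeConjectureFor (⨁ fun _ : Fin N => A).dim (⨁ fun _ : Fin N => A).X := by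
  haveI : Fact (Nat.Prime 2) := ⟨Nat.prime_two⟩
  have hpP : p.Prime := by rcases hp with rfl | rfl | rfl | rfl | rfl | rfl | rfl | rfl <;> norm_num
  have hp2 : p ≠ 2 := by rcases hp with rfl | rfl | rfl | rfl | rfl | rfl | rfl | rfl <;> omega
  haveI : Fact p.Prime := ⟨hpP⟩
  obtain ⟨S⟩ : Nonempty (Sylow 2 (K ≃ₐ[ℚ] K)) := inferInstance
  obtain ⟨-, hS⟩ := structure_of_forall_isNondegenerate_of_thirtytwo_dvd_of_prime_mem (by omega) hdeg hn hgood
  obtain ⟨-, hcyc | hdic⟩ := hS S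
  · -- shape C(r)
    obtain ⟨u, x, hu, hnorm, hx, -, -, r, hxu⟩ := hcyc
    haveI := hnorm
    have hx1 : x ^ 2 ^ n = 1 := by rw [← hx, pow_orderOf_eq_one]
    rcases hp with rfl | rfl | rfl | rfl | rfl | rfl | rfl | rfl
    · -- `p = 3`: `j = 1`
      obtain ⟨a, rfl⟩ : ∃ a, n = a + 1 + 1 := ⟨n - 2, by omega⟩
      exact hodgeConjectureFor_pow_of_shape_C hp2 le_rfl (by omega) hdeg hu hx hxu
        (pow_two_pow_mod_eq_one_of_conj hu hx1 hxu (by decide))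
        (not_two_pow_dvd_of_le (e := 2) (by omega) (by decide)) (not_two_pow_dvd_of_le (e := 3) (by omega) (by decide)) hA N
    · -- `p = 5`: `j = 2`
      obtain ⟨a, rfl⟩ : ∃ a, n = a + 2 + 1 := ⟨n - 3, by omega⟩
      exact hodgeConjectureFor_pow_of_shape_C hp2 (by norm_num) (by omega) hdeg hu hx hxu
        (pow_two_pow_mod_eq_one_of_conj hu hx1 hxu (by decide))
        (not_two_pow_dvd_of_le (e := 3) (by omega) (by decide)) (not_two_pow_dvd_of_le (e := 2) (by omega) (by decide)) hA N
    · -- `p = 7`: `j = 1`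
      obtain ⟨a, rfl⟩ : ∃ a, n = a + 1 + 1 := ⟨n - 2, by omega⟩
      exact hodgeConjectureFor_pow_of_shape_C hp2 le_rfl (by omega) hdeg hu hx hxu
        (pow_two_pow_mod_eq_one_of_conj hu hx1 hxu (by decide))
        (not_two_pow_dvd_of_le (e := 2) (by omega) (by decide)) (not_two_pow_dvd_of_le (e := 4) (by omega) (by decide)) hA N
    · -- `p = 11`: `j = 1`
      obtain ⟨a, rfl⟩ : ∃ a, n = a + 1 + 1 := ⟨n - 2, by omega⟩
      exact hodgeConjectureFor_pow_of_shape_C hp2 le_rfl (by omega) hdeg hu hx hxu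
        (pow_two_pow_mod_eq_one_of_conj hu hx1 hxu (by decide))
        (not_two_pow_dvd_of_le (e := 2) (by omega) (by decide)) (not_two_pow_dvd_of_le (e := 3) (by omega) (by decide)) hA N
    · -- `p = 13`: `j = 2`
      obtain ⟨a, rfl⟩ : ∃ a, n = a + 2 + 1 := ⟨n - 3, by omega⟩
      exact hodgeConjectureFor_pow_of_shape_C hp2 (by norm_num) (by omega) hdeg hu hx hxu
        (pow_two_pow_mod_eq_one_of_conj hu hx1 hxu (by decide))
        (not_two_pow_dvd_of_le (e := 3) (by omega) (by decide)) (not_two_pow_dvd_of_le (e := 2) (by omega) (by decide)) hA N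
    · -- `p = 19`: `j = 1`
      obtain ⟨a, rfl⟩ : ∃ a, n = a + 1 + 1 := ⟨n - 2, by omega⟩
      exact hodgeConjectureFor_pow_of_shape_C hp2 le_rfl (by omega) hdeg hu hx hxu
        (pow_two_pow_mod_eq_one_of_conj hu hx1 hxu (by decide))
        (not_two_pow_dvd_of_le (e := 2) (by omega) (by decide)) (not_two_pow_dvd_of_le (e := 3) (by omega) (by decide)) hA N
    · -- `p = 37`: `j = 2`
      obtain ⟨a, rfl⟩ : ∃ a, n = a + 2 + 1 := ⟨n - 3, by omega⟩
      exact hodgeConjectureFor_pow_of_shape_C hp2 (by norm_num) (by omega) hdeg hu hx hxu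
        (pow_two_pow_mod_eq_one_of_conj hu hx1 hxu (by decide))
        (not_two_pow_dvd_of_le (e := 3) (by omega) (by decide)) (not_two_pow_dvd_of_le (e := 2) (by omega) (by decide)) hA N
    · -- `p = 43`: `j = 1`
      obtain ⟨a, rfl⟩ : ∃ a, n = a + 1 + 1 := ⟨n - 2, by omega⟩
      exact hodgeConjectureFor_pow_of_shape_C hp2 le_rfl (by omega) hdeg hu hx hxu
        (pow_two_pow_mod_eq_one_of_conj hu hx1 hxu (by decide))
        (not_two_pow_dvd_of_le (e := 2) (by omega) (by decide)) (not_two_pow_dvd_of_le (e := 3) (by omega) (by decide)) hA N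
  · -- shape Dic
    obtain ⟨u, a, x, hu, -, ha, -, -, -, hxa, hxx, -, hau, hxu⟩ := hdic
    obtain ⟨k, rfl⟩ : ∃ k, n = k + 2 := ⟨n - 2, by omega⟩
    exact hodgeConjectureFor_pow_of_shape_dic hdeg hpP hp2 hu (by rw [ha, show k + 2 - 1 = k + 1 by omega]) hau hxu hxa
      (by rw [hxx, Nat.add_sub_cancel]) hA N

/-- **… and every such abelian variety is STABLY NONDEGENERATE.** [cite: Pohlmann1968, Thm. 1]
[cite: Shimura1998, §8.2 Prop. 26 and §32.10] [cite: Gordon1999HodgeAVSurvey, Thm. 6.4 and §9.3] -/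
theorem isStablyNondegenerate_of_forall_isNondegenerate_of_prime_mem_eight {n p : ℕ}
    (hp : p = 3 ∨ p = 5 ∨ p = 7 ∨ p = 11 ∨ p = 13 ∨ p = 19 ∨ p = 37 ∨ p = 43) (hdeg : Module.finrank ℚ K = 2 ^ n * p) (hn : 5 ≤ n)
    (hgood : ∀ (Ψ : CMType K) (φ : K →+* ℂ), IsPrimitive (ℂ ≃+* ℂ) Ψ.1 φ → IsNondegenerate Ψ)
    (hA : IsCMTypeRealisation Φ A ι θ) : IsStablyNondegenerate A := by
  haveI : Fact (Nat.Prime 2) := ⟨Nat.prime_two⟩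
  have hpP : p.Prime := by rcases hp with rfl | rfl | rfl | rfl | rfl | rfl | rfl | rfl <;> norm_num
  have hp2 : p ≠ 2 := by rcases hp with rfl | rfl | rfl | rfl | rfl | rfl | rfl | rfl <;> omega
  haveI : Fact p.Prime := ⟨hpP⟩
  obtain ⟨S⟩ : Nonempty (Sylow 2 (K ≃ₐ[ℚ] K)) := inferInstance
  obtain ⟨-, hS⟩ := structure_of_forall_isNondegenerate_of_thirtytwo_dvd_of_prime_mem (by omega) hdeg hn hgood
  obtain ⟨-, hcyc | hdic⟩ := hS S
  · obtain ⟨u, x, hu, hnorm, hx, -, -, r, hxu⟩ := hcyc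
    haveI := hnorm
    have hx1 : x ^ 2 ^ n = 1 := by rw [← hx, pow_orderOf_eq_one]
    rcases hp with rfl | rfl | rfl | rfl | rfl | rfl | rfl | rfl
    · -- `p = 3`: `j = 1`
      obtain ⟨a, rfl⟩ : ∃ a, n = a + 1 + 1 := ⟨n - 2, by omega⟩
      exact isStablyNondegenerate_of_shape_C hp2 le_rfl (by omega) hdeg hu hx hxu
        (pow_two_pow_mod_eq_one_of_conj hu hx1 hxu (by decide))
        (not_two_pow_dvd_of_le (e := 2) (by omega) (by decide)) (not_two_pow_dvd_of_le (e := 3) (by omega) (by decide)) hA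
    · -- `p = 5`: `j = 2`
      obtain ⟨a, rfl⟩ : ∃ a, n = a + 2 + 1 := ⟨n - 3, by omega⟩
      exact isStablyNondegenerate_of_shape_C hp2 (by norm_num) (by omega) hdeg hu hx hxu
        (pow_two_pow_mod_eq_one_of_conj hu hx1 hxu (by decide))
        (not_two_pow_dvd_of_le (e := 3) (by omega) (by decide)) (not_two_pow_dvd_of_le (e := 2) (by omega) (by decide)) hA
    · -- `p = 7`: `j = 1`
      obtain ⟨a, rfl⟩ : ∃ a, n = a + 1 + 1 := ⟨n - 2, by omega⟩
      exact isStablyNondegenerate_of_shape_C hp2 le_rfl (by omega) hdeg hu hx hxu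
        (pow_two_pow_mod_eq_one_of_conj hu hx1 hxu (by decide))
        (not_two_pow_dvd_of_le (e := 2) (by omega) (by decide)) (not_two_pow_dvd_of_le (e := 4) (by omega) (by decide)) hA
    · -- `p = 11`: `j = 1`
      obtain ⟨a, rfl⟩ : ∃ a, n = a + 1 + 1 := ⟨n - 2, by omega⟩
      exact isStablyNondegenerate_of_shape_C hp2 le_rfl (by omega) hdeg hu hx hxu
        (pow_two_pow_mod_eq_one_of_conj hu hx1 hxu (by decide))
        (not_two_pow_dvd_of_le (e := 2) (by omega) (by decide)) (not_two_pow_dvd_of_le (e := 3) (by omega) (by decide)) hA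
    · -- `p = 13`: `j = 2`
      obtain ⟨a, rfl⟩ : ∃ a, n = a + 2 + 1 := ⟨n - 3, by omega⟩
      exact isStablyNondegenerate_of_shape_C hp2 (by norm_num) (by omega) hdeg hu hx hxu
        (pow_two_pow_mod_eq_one_of_conj hu hx1 hxu (by decide))
        (not_two_pow_dvd_of_le (e := 3) (by omega) (by decide)) (not_two_pow_dvd_of_le (e := 2) (by omega) (by decide)) hA
    · -- `p = 19`: `j = 1`
      obtain ⟨a, rfl⟩ : ∃ a, n = a + 1 + 1 := ⟨n - 2, by omega⟩
      exact isStablyNondegenerate_of_shape_C hp2 le_rfl (by omega) hdeg hu hx hxu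
        (pow_two_pow_mod_eq_one_of_conj hu hx1 hxu (by decide))
        (not_two_pow_dvd_of_le (e := 2) (by omega) (by decide)) (not_two_pow_dvd_of_le (e := 3) (by omega) (by decide)) hA
    · -- `p = 37`: `j = 2`
      obtain ⟨a, rfl⟩ : ∃ a, n = a + 2 + 1 := ⟨n - 3, by omega⟩
      exact isStablyNondegenerate_of_shape_C hp2 (by norm_num) (by omega) hdeg hu hx hxu
        (pow_two_pow_mod_eq_one_of_conj hu hx1 hxu (by decide))
        (not_two_pow_dvd_of_le (e := 3) (by omega) (by decide)) (not_two_pow_dvd_of_le (e := 2) (by omega) (by decide)) hA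
    · -- `p = 43`: `j = 1`
      obtain ⟨a, rfl⟩ : ∃ a, n = a + 1 + 1 := ⟨n - 2, by omega⟩
      exact isStablyNondegenerate_of_shape_C hp2 le_rfl (by omega) hdeg hu hx hxu
        (pow_two_pow_mod_eq_one_of_conj hu hx1 hxu (by decide))
        (not_two_pow_dvd_of_le (e := 2) (by omega) (by decide)) (not_two_pow_dvd_of_le (e := 3) (by omega) (by decide)) hA
  · obtain ⟨u, a, x, hu, -, ha, -, -, -, hxa, hxx, -, hau, hxu⟩ := hdic
    obtain ⟨k, rfl⟩ : ∃ k, n = k + 2 := ⟨n - 2, by omega⟩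
    exact isStablyNondegenerate_of_shape_dic hdeg hpP hp2 hu (by rw [ha, show k + 2 - 1 = k + 1 by omega]) hau hxu hxa
      (by rw [hxx, Nat.add_sub_cancel]) hA

/-! ## §3 The dichotomy -/

omit [IsGalois ℚ K] in
/-- **THE HODGE DICHOTOMY FOR GALOIS CM FIELDS OF DEGREE `2ⁿ·p`, `p ∈ {3,5,7,11,13,19,37,43}`, `n ≥ 5`.**  EITHER every abelian variety with
complex multiplication by `K` (any CM type) satisfies the Hodge conjecture together with all its powers, OR `K` carries a SIMPLE
DEGENERATE CM abelian variety of dimension `[K:ℚ]/2` with a rational `(p,p)` class outside the divisor ring on some power (an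
exceptional Hodge class). [cite: Pohlmann1968, Thm. 1] [cite: Shimura1998, §6.2 Thm. 3, §8.2 Prop. 26 and §32.10]
[cite: Gordon1999HodgeAVSurvey, Thm. 6.4 and §9.3] -/
theorem hodge_dichotomy_of_prime_mem_eight [IsGalois ℚ K] {n p : ℕ} (hp : p = 3 ∨ p = 5 ∨ p = 7 ∨ p = 11 ∨ p = 13 ∨ p = 19 ∨ p = 37 ∨ p = 43)
    (hdeg : Module.finrank ℚ K = 2 ^ n * p) (hn : 5 ≤ n) :
    (∀ (Φ : CMType K) (A : AbelianVariety ℂ) (ι : 𝓞 K →+* End A) (θ : K →+* Module.End ℂ (complexBetti A.X 1)),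
        IsCMTypeRealisation Φ A ι θ → ∀ N : ℕ, HodgeConjectureFor (⨁ fun _ : Fin N => A).dim (⨁ fun _ : Fin N => A).X) ∨
      ∃ (Φ : CMType K) (φ : K →+* ℂ) (X : AbelianVariety ℂ) (ι : 𝓞 K →+* End X)
        (ϑ : K →+* Module.End ℂ (complexBetti X.X 1)),
        IsPrimitive (ℂ ≃+* ℂ) Φ.1 φ ∧ ¬ IsNondegenerate Φ ∧ IsCMTypeRealisation Φ X ι ϑ ∧ X.IsSimple ∧
        X.dim = Module.finrank ℚ K / 2 ∧
        ∃ n p : ℕ, ∃ x : complexBetti (⨁ fun _ : Fin n => X).X (2 * p), IsRationalClass x ∧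
          IsOfHodgeType (⨁ fun _ : Fin n => X).dim (⨁ fun _ : Fin n => X).X (2 * p) p p x ∧
          x ∉ divisorClassesSpan (⨁ fun _ : Fin n => X).X (⨁ fun _ : Fin n => X).dim p := by
  by_cases hgood : ∀ (Ψ : CMType K) (φ : K →+* ℂ), IsPrimitive (ℂ ≃+* ℂ) Ψ.1 φ → IsNondegenerate Ψ
  · exact Or.inl fun Φ A ι θ hA N => hodgeConjectureFor_pow_of_forall_isNondegenerate_of_prime_mem_eight hp hdeg hn hgood hA N
  · exact Or.inr (exists_simple_degenerate_of_not_forall_isNondegenerate hgood)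

/-! ## §4 Together with the `2`-power case (gen 37): `[K:ℚ] = 2ⁿ·M`, `M ∈ {1, 3, 5, 7, 11, 13, 19, 37, 43}` -/

/-- **`32 ∣ [K:ℚ] = 2ⁿ·M`, `M ∈ {1,3,5,7,11,13,19,37,43}`, `K` GOOD ⟹ the Hodge conjecture for all powers of every abelian variety with CM
by `K`** (`M = 1`: gen 37 `hodgeConjectureFor_pow_of_two_power`; `M = p`: §2). [cite: Pohlmann1968, Thm. 1]
[cite: Shimura1998, §8.2 Prop. 26 and §32.10] [cite: Gordon1999HodgeAVSurvey, Thm. 6.4 and §9.3] -/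
theorem hodgeConjectureFor_pow_of_forall_isNondegenerate_of_thirtytwo_dvd_of_mem {n M : ℕ}
    (hM : M = 1 ∨ M = 3 ∨ M = 5 ∨ M = 7 ∨ M = 11 ∨ M = 13 ∨ M = 19 ∨ M = 37 ∨ M = 43)
    (hdeg : Module.finrank ℚ K = 2 ^ n * M) (hn : 5 ≤ n)
    (hgood : ∀ (Ψ : CMType K) (φ : K →+* ℂ), IsPrimitive (ℂ ≃+* ℂ) Ψ.1 φ → IsNondegenerate Ψ)
    (hA : IsCMTypeRealisation Φ A ι θ) (N : ℕ) :
    HodgeConjectureFor (⨁ fun _ : Fin N => A).dim (⨁ fun _ : Fin N => A).X := by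
  rcases hM with rfl | hM
  · exact hodgeConjectureFor_pow_of_two_power (by rw [hdeg, mul_one]) hn hgood hA N
  · exact hodgeConjectureFor_pow_of_forall_isNondegenerate_of_prime_mem_eight hM hdeg hn hgood hA N

omit [IsGalois ℚ K] in
/-- **THE HODGE DICHOTOMY for Galois CM fields of degree `2ⁿ·M`, `n ≥ 5`, `M ∈ {1,3,5,7,11,13,19,37,43}`**: every abelian variety with
CM by `K` satisfies the Hodge conjecture together with all its powers, OR `K` carries a simple DEGENERATE CM abelian variety of
dimension `[K:ℚ]/2` with a rational `(p,p)` class outside the divisor ring on some power. [cite: Pohlmann1968, Thm. 1]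
[cite: Shimura1998, §6.2 Thm. 3, §8.2 Prop. 26 and §32.10] [cite: Gordon1999HodgeAVSurvey, Thm. 6.4 and §9.3] -/
theorem hodge_dichotomy_of_thirtytwo_dvd_of_mem [IsGalois ℚ K] {n M : ℕ}
    (hM : M = 1 ∨ M = 3 ∨ M = 5 ∨ M = 7 ∨ M = 11 ∨ M = 13 ∨ M = 19 ∨ M = 37 ∨ M = 43)
    (hdeg : Module.finrank ℚ K = 2 ^ n * M) (hn : 5 ≤ n) :
    (∀ (Φ : CMType K) (A : AbelianVariety ℂ) (ι : 𝓞 K →+* End A) (θ : K →+* Module.End ℂ (complexBetti A.X 1)),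
        IsCMTypeRealisation Φ A ι θ → ∀ N : ℕ, HodgeConjectureFor (⨁ fun _ : Fin N => A).dim (⨁ fun _ : Fin N => A).X) ∨
      ∃ (Φ : CMType K) (φ : K →+* ℂ) (X : AbelianVariety ℂ) (ι : 𝓞 K →+* End X)
        (ϑ : K →+* Module.End ℂ (complexBetti X.X 1)),
        IsPrimitive (ℂ ≃+* ℂ) Φ.1 φ ∧ ¬ IsNondegenerate Φ ∧ IsCMTypeRealisation Φ X ι ϑ ∧ X.IsSimple ∧
        X.dim = Module.finrank ℚ K / 2 ∧
        ∃ n p : ℕ, ∃ x : complexBetti (⨁ fun _ : Fin n => X).X (2 * p), IsRationalClass x ∧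
          IsOfHodgeType (⨁ fun _ : Fin n => X).dim (⨁ fun _ : Fin n => X).X (2 * p) p p x ∧
          x ∉ divisorClassesSpan (⨁ fun _ : Fin n => X).X (⨁ fun _ : Fin n => X).dim p := by
  by_cases hgood : ∀ (Ψ : CMType K) (φ : K →+* ℂ), IsPrimitive (ℂ ≃+* ℂ) Ψ.1 φ → IsNondegenerate Ψ
  · exact Or.inl fun Φ A ι θ hA N =>
      hodgeConjectureFor_pow_of_forall_isNondegenerate_of_thirtytwo_dvd_of_mem hM hdeg hn hgood hA N
  · exact Or.inr (exists_simple_degenerate_of_not_forall_isNondegenerate hgood)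

/-! ## §5 `p = 17`: degree `2ⁿ·17` with `n ≥ 8` -/

/-- **`p = 17`, `n ≥ 8`: a GOOD Galois CM field of degree `2ⁿ·17` satisfies the Hodge conjecture for all powers of every abelian variety
with CM by `K`.**  Here `16 ∣ p − 1`, so shape C(r) may have `ord r = 16` (`j = 4`), and gen 38's conditions `j ≤ a + 1`,
`2^{a+2} ∤ 16`, `2^{a+1} ∤ 18` (`n = a + j + 1`) need `n ≥ 8`. [cite: Pohlmann1968, Thm. 1] [cite: Shimura1998, §8.2 Prop. 26 and §32.10]
[cite: Gordon1999HodgeAVSurvey, Thm. 6.4 and §9.3] -/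
theorem hodgeConjectureFor_pow_of_forall_isNondegenerate_seventeen {n : ℕ} (hdeg : Module.finrank ℚ K = 2 ^ n * 17) (hn : 8 ≤ n)
    (hgood : ∀ (Ψ : CMType K) (φ : K →+* ℂ), IsPrimitive (ℂ ≃+* ℂ) Ψ.1 φ → IsNondegenerate Ψ)
    (hA : IsCMTypeRealisation Φ A ι θ) (N : ℕ) :
    HodgeConjectureFor (⨁ fun _ : Fin N => A).dim (⨁ fun _ : Fin N => A).X := by
  haveI : Fact (Nat.Prime 2) := ⟨Nat.prime_two⟩
  haveI : Fact (Nat.Prime 17) := ⟨by norm_num⟩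
  obtain ⟨S⟩ : Nonempty (Sylow 2 (K ≃ₐ[ℚ] K)) := inferInstance
  obtain ⟨-, hS⟩ := structure_of_forall_isNondegenerate_of_thirtytwo_dvd_of_prime_mem (p := 17) (by omega) hdeg (by omega) hgood
  obtain ⟨-, hcyc | hdic⟩ := hS S
  · obtain ⟨u, x, hu, hnorm, hx, -, -, r, hxu⟩ := hcyc
    haveI := hnorm
    have hx1 : x ^ 2 ^ n = 1 := by rw [← hx, pow_orderOf_eq_one]
    obtain ⟨a, rfl⟩ : ∃ a, n = a + 4 + 1 := ⟨n - 5, by omega⟩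
    exact hodgeConjectureFor_pow_of_shape_C (p := 17) (by norm_num) (by norm_num) (by omega) hdeg hu hx hxu
      (pow_two_pow_mod_eq_one_of_conj hu hx1 hxu (by decide))
      (not_two_pow_dvd_of_le (e := 5) (by omega) (by decide)) (not_two_pow_dvd_of_le (e := 2) (by omega) (by decide)) hA N
  · obtain ⟨u, a, x, hu, -, ha, -, -, -, hxa, hxx, -, hau, hxu⟩ := hdic
    obtain ⟨k, rfl⟩ : ∃ k, n = k + 2 := ⟨n - 2, by omega⟩
    exact hodgeConjectureFor_pow_of_shape_dic hdeg (by norm_num) (by norm_num) hu (by rw [ha, show k + 2 - 1 = k + 1 by omega])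
      hau hxu hxa (by rw [hxx, Nat.add_sub_cancel]) hA N

end Summit.HodgeConjecture.CorCM.GaloisModels



end
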